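import Summits.Parity.GeneralizedHardyLittlewood.Theorems.PrimeLevelFamEdgeIdeaDeltasPeterssonLayersBands
import Literature.NumberTheory.LFunctions.KMVMomentAsymptoticsUniqueness
import HarnessLib

/-!
# Route `PrimeLevelFamEdge`, crux K_A `MomentsBeyondDiagonal` (stmt-Parity-20007), line «petersson_layers» v3:
# THE QUANTIFIER LEDGER OF THE LINE, kernel-checked (lead prover, 2026-08-28)

The crux `MomentsBeyondDiagonal := ∃ Δ > 1, ∃ T₁ T₂ : ℝ → ℝ[X] → ℝ[X] → ℝ, KMV2000.MomentAsymptotics 1 Δ T₁ T₂` and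
every piece `SubOf F := ∃ Δ > 1, ∃ t, HasShape F Δ t` of the registered line
`Cruxes/MomentsBeyondDiagonal/Lines/petersson_layers.lean` (Theorems-side twin: decks 21a–21c,
`PrimeLevelFamEdgeIdeaDeltasPeterssonLayers{Split,Heart,Bands}`) quantify `∃` over LEVEL-FREE main-term
functionals BEFORE the level `q`. This file proves what that quantifier does and does not carry:

* §1 **Pointwise (Skolem) form.** Because the functionals are otherwise unconstrained, `∃ T₁ T₂` (resp. `∃ t`)
  commutes with `∀ (P, Q, Δ')`: `MomentsBeyondDiagonal` ⟺ «on some window `(1, Δ]`, for EVERY `(P, Q, Δ')`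
  separately there are REAL NUMBERS `t₁, t₂` such that the two displays hold for all large good primes»
  (`momentsBeyondDiagonal_iff_pointwise`), and likewise `SubOf F` (`subOf_iff_pointwise`). So the only
  uniformity in K_A is the window `∃ Δ > 1`; the functionals carry no regularity in `(Δ', P, Q)`.
* §2 **Subsequence rigidity / uniqueness.** The number `t` in `HasShape F Δ t` at `(Δ', P, Q)` is pinned by
  the values of `F` along ANY unbounded set of good primes (`hasShape_eq_of_frequently`): a competing constant
  `t'` fitting `F` within `C' q̂ log⁻³ q̂` infinitely often equals `t Δ' P Q`. Hence two functionals with the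
  shape agree wherever good primes are unbounded (`hasShape_unique`), unconditionally on `Δ' < 2`
  (`hasShape_unique_of_lt_two`, via the tree's `KMV2000.goodPrimesUnbounded_of_lt_two`).
* §3 **Convergence reading.** `HasShape F Δ t` says the normalised values `F/(2ζ(2)² q̂/(Δ'² log² q̂))`
  converge to `t Δ' P Q` along the good primes, at rate `O(1/log q̂)`; in particular with relative error
  `→ 0` (`hasShape_relError`).
* §4 **Where the ∀-in-q burden sits in the line.** Every registered stub of «petersson_layers»
  (`stub_diag/rung/core/band/farP : SubOf _`, `stub_identP : TailNearFar _`, `stub_first : SubFirst`) is an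
  «∃ C q₀, ∀ prime q ≥ q₀» statement; by §2 the level-free functional of each explicit piece — in particular
  of the CORE `SubUpper rhoCore` (layers `2 ≤ r ≤ q̂^{3(Δ'−1)+1/10}`, the (A)-sensitive residence of the
  route's barrier notes) — is THE limit of that piece along all large primes, determined already by any
  infinite set of good primes (`subUpper_rhoCore_limit_unique`). A proof of `stub_core` must therefore
  control the core layers at EVERY large prime level (no infinitely-often weakening is available inside
  `SubOf`), which is exactly the quantifier strength the route's `closes` consumes downstream (the level is
  chosen relative to a putative exceptional modulus). Nothing here asserts that any piece HAS the shape.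

HONESTY. Bookkeeping about quantifiers only: no moment asymptotic, no piece of K_A, no bilinear Kloosterman
bound and no exceptional-zero statement (no Landau–Siegel / Siegel-zero exclusion, no GRH) is proved or
claimed here. The second mollified moment beyond the diagonal at an individual prime level is OPEN IN PRINT
(registry famE-02; [KowalskiMichelVanderKam2000, Prop. 5.1] needs `Δ < 1`).
-/

noncomputable section

open scoped Real
open Complex Polynomial
open Literature.NumberTheory.LFunctions

namespace Summit.Parity.GeneralizedHardyLittlewood.Theorems.PrimeLevelFamEdgeIdeaDeltas.PeterssonLayers

open Summit.Parity.GeneralizedHardyLittlewood.Theses.PrimeLevelFamEdge (MomentsBeyondDiagonal)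

/-! ## §1. Pointwise (Skolem) forms: the level-free functionals carry no uniformity in `(Δ', P, Q)` -/

/-- **K_A in pointwise form.** `MomentsBeyondDiagonal` holds iff on some window `(1, Δ]`, for every admissible
`P`, even-or-odd `Q` and `Δ' ∈ (1, Δ]` SEPARATELY, there are real numbers `t₁, t₂` (and `C, q₀`) such that the
two KMV displays hold with main terms `linForm + t₁`, `secondMomentForm + t₂` at every good prime `q ≥ q₀`.
(`∃ T₁ T₂` before `∀ P Q Δ'` is recovered by choice: the functionals are unconstrained.) -/
theorem momentsBeyondDiagonal_iff_pointwise :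
    MomentsBeyondDiagonal ↔
      ∃ Δ : ℝ, 1 < Δ ∧ ∀ P Q : ℝ[X], KMV2000.Admissible P → KMV2000.IsEvenOrOdd Q →
        ∀ Δ' : ℝ, 1 < Δ' → Δ' ≤ Δ → ∃ t₁ t₂ C : ℝ, ∃ q₀ : ℕ, ∀ (q : ℕ) [NeZero q], q.Prime → q₀ ≤ q →
          (∀ n : ℕ, (n : ℝ) ≠ KMV2000.qhat q ^ Δ') →
            ‖KMV2000.LhPQ q P Q (KMV2000.qhat q ^ Δ') -
                ((riemannZeta 2 *
                    ((Real.sqrt (KMV2000.qhat q) / (Δ' * Real.log (KMV2000.qhat q)) : ℝ) : ℂ)) *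
                  ((KMV2000.linForm Δ' P Q + t₁ : ℝ) : ℂ))‖ ≤
              C * Real.sqrt (KMV2000.qhat q) * (Real.log (KMV2000.qhat q))⁻¹ ^ 2 ∧
            ‖KMV2000.QhPQ q P Q (KMV2000.qhat q ^ Δ') -
                ((2 * riemannZeta 2 ^ 2 *
                    ((KMV2000.qhat q / (Δ' ^ 2 * Real.log (KMV2000.qhat q) ^ 2) : ℝ) : ℂ)) *
                  ((KMV2000.secondMomentForm Δ' P Q + t₂ : ℝ) : ℂ))‖ ≤
              C * KMV2000.qhat q * (Real.log (KMV2000.qhat q))⁻¹ ^ 3 := by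
  constructor
  · rintro ⟨Δ, hΔ, T₁, T₂, H⟩
    refine ⟨Δ, hΔ, fun P Q hP hQ Δ' h1 h2 ↦ ?_⟩
    obtain ⟨C, q₀, hC⟩ := H P Q hP hQ Δ' h1 h2
    exact ⟨T₁ Δ' P Q, T₂ Δ' P Q, C, q₀, fun q _ hq hq₀ hn ↦ hC q hq hq₀ hn⟩
  · rintro ⟨Δ, hΔ, H⟩
    classical
    refine ⟨Δ, hΔ,
      fun Δ' P Q ↦ if h : KMV2000.Admissible P ∧ KMV2000.IsEvenOrOdd Q ∧ 1 < Δ' ∧ Δ' ≤ Δ then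
        (H P Q h.1 h.2.1 Δ' h.2.2.1 h.2.2.2).choose else 0,
      fun Δ' P Q ↦ if h : KMV2000.Admissible P ∧ KMV2000.IsEvenOrOdd Q ∧ 1 < Δ' ∧ Δ' ≤ Δ then
        (H P Q h.1 h.2.1 Δ' h.2.2.1 h.2.2.2).choose_spec.choose else 0, ?_⟩
    intro P Q hP hQ Δ' h1 h2
    have hc : KMV2000.Admissible P ∧ KMV2000.IsEvenOrOdd Q ∧ 1 < Δ' ∧ Δ' ≤ Δ := ⟨hP, hQ, h1, h2⟩
    obtain ⟨C, q₀, hh⟩ := (H P Q hP hQ Δ' h1 h2).choose_spec.choose_spec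
    refine ⟨C, q₀, fun q _ hq hq₀ hn ↦ ?_⟩
    simp only [dif_pos hc]
    exact hh q hq hq₀ hn

/-- **A line piece in pointwise form.** `SubOf F` holds iff on some window `(1, Δ]`, for every `(P, Q, Δ')`
separately, there is a real number `t` (and `C, q₀`) with `‖F − 2ζ(2)² q̂/(Δ'² log² q̂)·t‖ ≤ C q̂ log⁻³ q̂` at
every good prime `q ≥ q₀`. -/
theorem subOf_iff_pointwise (F : LevelFamily) :
    SubOf F ↔
      ∃ Δ : ℝ, 1 < Δ ∧ ∀ P Q : ℝ[X], KMV2000.Admissible P → KMV2000.IsEvenOrOdd Q →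
        ∀ Δ' : ℝ, 1 < Δ' → Δ' ≤ Δ → ∃ t C : ℝ, ∃ q₀ : ℕ, ∀ (q : ℕ) [NeZero q], q.Prime → q₀ ≤ q →
          (∀ n : ℕ, (n : ℝ) ≠ KMV2000.qhat q ^ Δ') →
            ‖F q P Q Δ' -
                ((2 * riemannZeta 2 ^ 2 *
                    ((KMV2000.qhat q / (Δ' ^ 2 * Real.log (KMV2000.qhat q) ^ 2) : ℝ) : ℂ)) *
                  ((t : ℝ) : ℂ))‖ ≤
              C * KMV2000.qhat q * (Real.log (KMV2000.qhat q))⁻¹ ^ 3 := by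
  constructor
  · rintro ⟨Δ, hΔ, t, H⟩
    refine ⟨Δ, hΔ, fun P Q hP hQ Δ' h1 h2 ↦ ?_⟩
    obtain ⟨C, q₀, hC⟩ := H P Q hP hQ Δ' h1 h2
    exact ⟨t Δ' P Q, C, q₀, fun q _ hq hq₀ hn ↦ hC q hq hq₀ hn⟩
  · rintro ⟨Δ, hΔ, H⟩
    classical
    refine ⟨Δ, hΔ,
      fun Δ' P Q ↦ if h : KMV2000.Admissible P ∧ KMV2000.IsEvenOrOdd Q ∧ 1 < Δ' ∧ Δ' ≤ Δ then
        (H P Q h.1 h.2.1 Δ' h.2.2.1 h.2.2.2).choose else 0, ?_⟩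
    intro P Q hP hQ Δ' h1 h2
    have hc : KMV2000.Admissible P ∧ KMV2000.IsEvenOrOdd Q ∧ 1 < Δ' ∧ Δ' ≤ Δ := ⟨hP, hQ, h1, h2⟩
    obtain ⟨C, q₀, hh⟩ := (H P Q hP hQ Δ' h1 h2).choose_spec
    refine ⟨C, q₀, fun q _ hq hq₀ hn ↦ ?_⟩
    simp only [dif_pos hc]
    exact hh q hq hq₀ hn

/-! ## §2. Subsequence rigidity and uniqueness of the level-free functional -/

/-- **SUBSEQUENCE RIGIDITY.** If `F` has the second-display shape on `(1, Δ]` with functional `t`, and at some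
`(Δ', P, Q)` of the window a constant `t'` also fits `F` within `C' q̂ log⁻³ q̂` along an UNBOUNDED set of good
primes, then `t' = t Δ' P Q`: the functional is determined by the values of `F` along any infinite set of good
primes (the two main terms differ by `2ζ(2)² q̂/(Δ'² log² q̂)·|t − t'|`, which beats `(C + C') q̂ log⁻³ q̂` once
`log q̂` is large). -/
theorem hasShape_eq_of_frequently {F : LevelFamily} {Δ : ℝ} {t : ℝ → ℝ[X] → ℝ[X] → ℝ}
    (h : HasShape F Δ t) {P Q : ℝ[X]} (hP : KMV2000.Admissible P) (hQ : KMV2000.IsEvenOrOdd Q)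
    {Δ' : ℝ} (h1 : 1 < Δ') (h2 : Δ' ≤ Δ) {t' C' : ℝ}
    (hio : ∀ q₀ : ℕ, ∃ q : ℕ, ∃ _ : NeZero q, q.Prime ∧ q₀ ≤ q ∧
      (∀ n : ℕ, (n : ℝ) ≠ KMV2000.qhat q ^ Δ') ∧
        ‖F q P Q Δ' -
            ((2 * riemannZeta 2 ^ 2 *
                ((KMV2000.qhat q / (Δ' ^ 2 * Real.log (KMV2000.qhat q) ^ 2) : ℝ) : ℂ)) *
              ((t' : ℝ) : ℂ))‖ ≤
          C' * KMV2000.qhat q * (Real.log (KMV2000.qhat q))⁻¹ ^ 3) :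
    t' = t Δ' P Q := by
  by_contra hne
  obtain ⟨C, q₀, hC⟩ := h P Q hP hQ Δ' h1 h2
  set δ : ℝ := |t Δ' P Q - t'| with hδ
  have hδpos : 0 < δ := abs_pos.2 (sub_ne_zero.2 (Ne.symm hne))
  have hΔ'pos : 0 < Δ' := zero_lt_one.trans h1
  have hz1 : riemannZeta 2 ≠ 0 := riemannZeta_ne_zero_of_one_le_re (by norm_num)
  have hz : (2 * riemannZeta 2 ^ 2 : ℂ) ≠ 0 := mul_ne_zero two_ne_zero (pow_ne_zero 2 hz1)
  have hzpos : 0 < ‖(2 * riemannZeta 2 ^ 2 : ℂ)‖ := norm_pos_iff.2 hz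
  set B : ℝ := (|C| + |C'|) * Δ' ^ 2 / (‖(2 * riemannZeta 2 ^ 2 : ℂ)‖ * δ) + 1 with hB
  obtain ⟨N, hN⟩ := KMV2000.exists_log_qhat_ge B
  obtain ⟨q, inst, hq, hqge, hgoodq, b1'⟩ := hio (max q₀ N)
  have hq0 : q₀ ≤ q := le_trans (le_max_left _ _) hqge
  have hqN : N ≤ q := le_trans (le_max_right _ _) hqge
  have hlg : B ≤ Real.log (KMV2000.qhat q) := hN q hqN
  have hB1 : 1 ≤ B := by
    have : 0 ≤ (|C| + |C'|) * Δ' ^ 2 / (‖(2 * riemannZeta 2 ^ 2 : ℂ)‖ * δ) := by positivity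
    linarith
  have hlgpos : 0 < Real.log (KMV2000.qhat q) := by linarith
  have hqhatpos : 0 < KMV2000.qhat q := by
    unfold KMV2000.qhat
    have : 0 < (q : ℝ) := by exact_mod_cast hq.pos
    positivity
  have b1 := hC q hq hq0 hgoodq
  set L := F q P Q Δ' with hL
  set r : ℝ := KMV2000.qhat q / (Δ' ^ 2 * Real.log (KMV2000.qhat q) ^ 2) with hr
  have hrpos : 0 < r := by rw [hr]; positivity
  set A : ℂ := 2 * riemannZeta 2 ^ 2 * ((r : ℝ) : ℂ) * ((t Δ' P Q : ℝ) : ℂ) with hA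
  set A' : ℂ := 2 * riemannZeta 2 ^ 2 * ((r : ℝ) : ℂ) * ((t' : ℝ) : ℂ) with hA'
  have hdiff : ‖A - A'‖ ≤ (|C| + |C'|) * KMV2000.qhat q * (Real.log (KMV2000.qhat q))⁻¹ ^ 3 := by
    have e : A - A' = (L - A') - (L - A) := by ring
    rw [e]
    refine (norm_sub_le _ _).trans ?_
    have hs2 : 0 ≤ KMV2000.qhat q * (Real.log (KMV2000.qhat q))⁻¹ ^ 3 := by positivity
    have hb : ‖L - A‖ ≤ |C| * KMV2000.qhat q * (Real.log (KMV2000.qhat q))⁻¹ ^ 3 := by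
      refine b1.trans ?_
      rw [mul_assoc, mul_assoc]
      exact mul_le_mul_of_nonneg_right (le_abs_self C) hs2
    have hb' : ‖L - A'‖ ≤ |C'| * KMV2000.qhat q * (Real.log (KMV2000.qhat q))⁻¹ ^ 3 := by
      refine b1'.trans ?_
      rw [mul_assoc, mul_assoc]
      exact mul_le_mul_of_nonneg_right (le_abs_self C') hs2
    nlinarith
  have hnormA : ‖A - A'‖ = ‖(2 * riemannZeta 2 ^ 2 : ℂ)‖ * r * δ := by
    have e : A - A' = (2 * riemannZeta 2 ^ 2) * ((r : ℝ) : ℂ) * (((t Δ' P Q - t' : ℝ)) : ℂ) := by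
      rw [hA, hA']
      push_cast
      ring
    rw [e, norm_mul, norm_mul, Complex.norm_real, Complex.norm_real, Real.norm_eq_abs, Real.norm_eq_abs,
      abs_of_pos hrpos, hδ]
  have key : ‖(2 * riemannZeta 2 ^ 2 : ℂ)‖ * δ * Real.log (KMV2000.qhat q) / Δ' ^ 2 ≤ |C| + |C'| := by
    have h3 := hnormA ▸ hdiff
    rw [hr] at h3
    have hΔ2 : 0 < Δ' ^ 2 := by positivity
    rw [div_le_iff₀ hΔ2]
    have e1 : ‖(2 * riemannZeta 2 ^ 2 : ℂ)‖ *
          (KMV2000.qhat q / (Δ' ^ 2 * Real.log (KMV2000.qhat q) ^ 2)) * δ =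
        (‖(2 * riemannZeta 2 ^ 2 : ℂ)‖ * δ * Real.log (KMV2000.qhat q)) *
          (KMV2000.qhat q / (Δ' ^ 2 * Real.log (KMV2000.qhat q) ^ 3)) := by
      field_simp
    have e2 : (|C| + |C'|) * KMV2000.qhat q * (Real.log (KMV2000.qhat q))⁻¹ ^ 3 =
        ((|C| + |C'|) * Δ' ^ 2) * (KMV2000.qhat q / (Δ' ^ 2 * Real.log (KMV2000.qhat q) ^ 3)) := by
      field_simp
    rw [e1, e2] at h3
    have hw : 0 < KMV2000.qhat q / (Δ' ^ 2 * Real.log (KMV2000.qhat q) ^ 3) := by positivity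
    exact le_of_mul_le_mul_right h3 hw
  have hzd : 0 < ‖(2 * riemannZeta 2 ^ 2 : ℂ)‖ * δ := mul_pos hzpos hδpos
  have hΔ2 : 0 < Δ' ^ 2 := by positivity
  have key2 : ‖(2 * riemannZeta 2 ^ 2 : ℂ)‖ * δ * B / Δ' ^ 2 ≤ |C| + |C'| := by
    refine le_trans ?_ key
    rw [div_le_div_iff_of_pos_right hΔ2]
    exact mul_le_mul_of_nonneg_left hlg hzd.le
  rw [hB] at key2
  have e3 : ‖(2 * riemannZeta 2 ^ 2 : ℂ)‖ * δ *
        ((|C| + |C'|) * Δ' ^ 2 / (‖(2 * riemannZeta 2 ^ 2 : ℂ)‖ * δ) + 1) / Δ' ^ 2 =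
      (|C| + |C'|) + ‖(2 * riemannZeta 2 ^ 2 : ℂ)‖ * δ / Δ' ^ 2 := by
    field_simp
  rw [e3] at key2
  have : 0 < ‖(2 * riemannZeta 2 ^ 2 : ℂ)‖ * δ / Δ' ^ 2 := div_pos hzd hΔ2
  linarith

/-- **UNIQUENESS of the level-free functional.** Two functionals giving `F` the second-display shape on the same
window agree at every `(Δ', P, Q)` of the window for which good primes are unbounded. -/
theorem hasShape_unique {F : LevelFamily} {Δ : ℝ} {t t' : ℝ → ℝ[X] → ℝ[X] → ℝ}
    (h : HasShape F Δ t) (h' : HasShape F Δ t') {P Q : ℝ[X]} (hP : KMV2000.Admissible P)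
    (hQ : KMV2000.IsEvenOrOdd Q) {Δ' : ℝ} (h1 : 1 < Δ') (h2 : Δ' ≤ Δ)
    (hgood : KMV2000.GoodPrimesUnbounded Δ') : t Δ' P Q = t' Δ' P Q := by
  obtain ⟨C', q₀', hC'⟩ := h' P Q hP hQ Δ' h1 h2
  refine (hasShape_eq_of_frequently h hP hQ h1 h2 (t' := t' Δ' P Q) (C' := C') fun q₀ ↦ ?_).symm
  obtain ⟨q, inst, hq, hqge, hgoodq⟩ := hgood (max q₀ q₀')
  exact ⟨q, inst, hq, le_trans (le_max_left _ _) hqge, hgoodq,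
    hC' q hq (le_trans (le_max_right _ _) hqge) hgoodq⟩

/-- **UNIQUENESS, hypothesis-free on `Δ' < 2`** (good primes are unbounded there:
`KMV2000.goodPrimesUnbounded_of_lt_two`). Every window of interest of the line lies inside `(1, 3/2]`. -/
theorem hasShape_unique_of_lt_two {F : LevelFamily} {Δ : ℝ} {t t' : ℝ → ℝ[X] → ℝ[X] → ℝ}
    (h : HasShape F Δ t) (h' : HasShape F Δ t') {P Q : ℝ[X]} (hP : KMV2000.Admissible P)
    (hQ : KMV2000.IsEvenOrOdd Q) {Δ' : ℝ} (h1 : 1 < Δ') (h2 : Δ' ≤ Δ) (h3 : Δ' < 2) :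
    t Δ' P Q = t' Δ' P Q :=
  hasShape_unique h h' hP hQ h1 h2 (KMV2000.goodPrimesUnbounded_of_lt_two (zero_lt_one.trans h1) h3)

/-- The window can always be shrunk: `HasShape F Δ t → HasShape F Δ₀ t` for `Δ₀ ≤ Δ`. -/
theorem hasShape_mono {F : LevelFamily} {Δ Δ₀ : ℝ} {t : ℝ → ℝ[X] → ℝ[X] → ℝ} (h : HasShape F Δ t)
    (hΔ : Δ₀ ≤ Δ) : HasShape F Δ₀ t :=
  fun P Q hP hQ Δ' h1 h2 ↦ h P Q hP hQ Δ' h1 (h2.trans hΔ)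

/-- Hence a piece `SubOf F` always has a witness window inside `(1, 3/2]`, on which its functional is unique
(`hasShape_unique_of_lt_two`). -/
theorem subOf_iff_small_window (F : LevelFamily) :
    SubOf F ↔ ∃ Δ : ℝ, 1 < Δ ∧ Δ ≤ 3 / 2 ∧ ∃ t : ℝ → ℝ[X] → ℝ[X] → ℝ, HasShape F Δ t := by
  constructor
  · rintro ⟨Δ, hΔ, t, H⟩
    exact ⟨min Δ (3 / 2), lt_min hΔ (by norm_num), min_le_right _ _, t, hasShape_mono H (min_le_left _ _)⟩
  · rintro ⟨Δ, hΔ, -, t, H⟩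
    exact ⟨Δ, hΔ, t, H⟩

/-! ## §3. The convergence reading: relative error `→ 0` along the good primes -/

/-- **`HasShape` = convergence of the normalised piece.** If `F` has the shape with functional `t`, then for every
`ε > 0` eventually (in good primes `q`) `‖F − N₂(q,Δ')·t‖ ≤ ε·(q̂/(Δ'² log² q̂))`, `N₂ = 2ζ(2)² q̂/(Δ'² log² q̂)`:
the values `F/N₂` converge to the real number `t Δ' P Q` (rate `O(1/log q̂)` by the hypothesis itself). -/
theorem hasShape_relError {F : LevelFamily} {Δ : ℝ} {t : ℝ → ℝ[X] → ℝ[X] → ℝ} (h : HasShape F Δ t)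
    {P Q : ℝ[X]} (hP : KMV2000.Admissible P) (hQ : KMV2000.IsEvenOrOdd Q) {Δ' : ℝ} (h1 : 1 < Δ')
    (h2 : Δ' ≤ Δ) {ε : ℝ} (hε : 0 < ε) :
    ∃ q₀ : ℕ, ∀ (q : ℕ) [NeZero q], q.Prime → q₀ ≤ q → (∀ n : ℕ, (n : ℝ) ≠ KMV2000.qhat q ^ Δ') →
      ‖F q P Q Δ' -
          ((2 * riemannZeta 2 ^ 2 *
              ((KMV2000.qhat q / (Δ' ^ 2 * Real.log (KMV2000.qhat q) ^ 2) : ℝ) : ℂ)) *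
            ((t Δ' P Q : ℝ) : ℂ))‖ ≤
        ε * (KMV2000.qhat q / (Δ' ^ 2 * Real.log (KMV2000.qhat q) ^ 2)) := by
  obtain ⟨C, q₀, hC⟩ := h P Q hP hQ Δ' h1 h2
  have hΔ'pos : 0 < Δ' := zero_lt_one.trans h1
  obtain ⟨N, hN⟩ := KMV2000.exists_log_qhat_ge (|C| * Δ' ^ 2 / ε + 1)
  refine ⟨max q₀ N, fun q _ hq hq₀ hn ↦ ?_⟩
  have hlg : |C| * Δ' ^ 2 / ε + 1 ≤ Real.log (KMV2000.qhat q) := hN q (le_trans (le_max_right _ _) hq₀)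
  have hlgpos : 0 < Real.log (KMV2000.qhat q) := by
    have : 0 ≤ |C| * Δ' ^ 2 / ε := by positivity
    linarith
  have hqhatpos : 0 < KMV2000.qhat q := by
    unfold KMV2000.qhat
    have : 0 < (q : ℝ) := by exact_mod_cast hq.pos
    positivity
  refine (hC q hq (le_trans (le_max_left _ _) hq₀) hn).trans ?_
  have hs2 : 0 ≤ KMV2000.qhat q * (Real.log (KMV2000.qhat q))⁻¹ ^ 3 := by positivity
  calc C * KMV2000.qhat q * (Real.log (KMV2000.qhat q))⁻¹ ^ 3
      ≤ |C| * KMV2000.qhat q * (Real.log (KMV2000.qhat q))⁻¹ ^ 3 := by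
        rw [mul_assoc, mul_assoc]
        exact mul_le_mul_of_nonneg_right (le_abs_self C) hs2
    _ = (|C| * Δ' ^ 2 / Real.log (KMV2000.qhat q)) *
          (KMV2000.qhat q / (Δ' ^ 2 * Real.log (KMV2000.qhat q) ^ 2)) := by
        field_simp
    _ ≤ ε * (KMV2000.qhat q / (Δ' ^ 2 * Real.log (KMV2000.qhat q) ^ 2)) := by
        refine mul_le_mul_of_nonneg_right ?_ (by positivity)
        rw [div_le_iff₀ hlgpos]
        have h' : |C| * Δ' ^ 2 / ε ≤ Real.log (KMV2000.qhat q) := by linarith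
        rw [div_le_iff₀ hε] at h'
        linarith [mul_comm ε (Real.log (KMV2000.qhat q))]

/-! ## §4. The registered stubs of «petersson_layers»: every piece is eventually-∀ in the level, and the CORE's
functional is the limit of the core layers along all large primes -/

/-- **The CORE piece pins its functional (∀-in-q ledger entry for `stub_core`).** If the core layers
`upper rhoCore` (Petersson moduli `q·r`, `2 ≤ r ≤ q̂^{3(Δ'−1)+1/10}`) have the second-display shape on `(1, Δ]`
with two functionals `t, t'`, these agree at every `(Δ', P, Q)` of the window with `Δ' < 2`: the «level-free
main term» of `stub_core : SubUpper rhoCore` is not a free parameter but THE limit of the normalised core layers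
along the good primes — fixed already by any infinite set of them (`hasShape_eq_of_frequently`), asserted at
ALL large ones. -/
theorem subUpper_rhoCore_limit_unique {Δ : ℝ} {t t' : ℝ → ℝ[X] → ℝ[X] → ℝ}
    (h : HasShape (fun q _ P Q Δ' ↦ upper q rhoCore P Q Δ') Δ t)
    (h' : HasShape (fun q _ P Q Δ' ↦ upper q rhoCore P Q Δ') Δ t') {P Q : ℝ[X]}
    (hP : KMV2000.Admissible P) (hQ : KMV2000.IsEvenOrOdd Q) {Δ' : ℝ} (h1 : 1 < Δ') (h2 : Δ' ≤ Δ)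
    (h3 : Δ' < 2) : t Δ' P Q = t' Δ' P Q :=
  hasShape_unique_of_lt_two h h' hP hQ h1 h2 h3

/-- The same for the RUNG `r = 1` (`stub_rung : SubRung`), the generic BAND (`stub_band : SubBand rhoCore rhoP`),
the FAR layers (`stub_farP : SubFar rhoP`) and the DIAGONAL part (`stub_diag : SubDiag`): each is `SubOf` of an
explicit level family, so each functional is the limit of its piece along the good primes; stated once for an
arbitrary level family as the pointwise-limit form of `SubOf`. -/
theorem subOf_iff_pointwise_unique (F : LevelFamily) :
    SubOf F ↔
      ∃ Δ : ℝ, 1 < Δ ∧ Δ ≤ 3 / 2 ∧ ∀ P Q : ℝ[X], KMV2000.Admissible P → KMV2000.IsEvenOrOdd Q →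
        ∀ Δ' : ℝ, 1 < Δ' → Δ' ≤ Δ → ∃! t : ℝ, ∃ C : ℝ, ∃ q₀ : ℕ, ∀ (q : ℕ) [NeZero q], q.Prime → q₀ ≤ q →
          (∀ n : ℕ, (n : ℝ) ≠ KMV2000.qhat q ^ Δ') →
            ‖F q P Q Δ' -
                ((2 * riemannZeta 2 ^ 2 *
                    ((KMV2000.qhat q / (Δ' ^ 2 * Real.log (KMV2000.qhat q) ^ 2) : ℝ) : ℂ)) *
                  ((t : ℝ) : ℂ))‖ ≤
              C * KMV2000.qhat q * (Real.log (KMV2000.qhat q))⁻¹ ^ 3 := by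
  constructor
  · rintro ⟨Δ, hΔ, t, H⟩
    refine ⟨min Δ (3 / 2), lt_min hΔ (by norm_num), min_le_right _ _, fun P Q hP hQ Δ' h1 h2 ↦ ?_⟩
    have h2' : Δ' ≤ Δ := h2.trans (min_le_left _ _)
    have h3 : Δ' < 2 := lt_of_le_of_lt (h2.trans (min_le_right _ _)) (by norm_num)
    obtain ⟨C, q₀, hC⟩ := H P Q hP hQ Δ' h1 h2'
    refine ⟨t Δ' P Q, ⟨C, q₀, fun q _ hq hq₀ hn ↦ hC q hq hq₀ hn⟩, ?_⟩
    rintro t' ⟨C', q₀', hC'⟩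
    refine hasShape_eq_of_frequently H hP hQ h1 h2' (t' := t') (C' := C') fun q₁ ↦ ?_
    obtain ⟨q, inst, hq, hqge, hgoodq⟩ :=
      KMV2000.goodPrimesUnbounded_of_lt_two (zero_lt_one.trans h1) h3 (max q₁ q₀')
    exact ⟨q, inst, hq, le_trans (le_max_left _ _) hqge, hgoodq,
      hC' q hq (le_trans (le_max_right _ _) hqge) hgoodq⟩
  · rintro ⟨Δ, hΔ, -, H⟩
    rw [subOf_iff_pointwise]
    refine ⟨Δ, hΔ, fun P Q hP hQ Δ' h1 h2 ↦ ?_⟩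
    obtain ⟨t, ⟨C, q₀, hC⟩, -⟩ := H P Q hP hQ Δ' h1 h2
    exact ⟨t, C, q₀, fun q _ hq hq₀ hn ↦ hC q hq hq₀ hn⟩

end Summit.Parity.GeneralizedHardyLittlewood.Theorems.PrimeLevelFamEdgeIdeaDeltas.PeterssonLayers

end
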